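import Summits.CriticalPhenomena.PercolationContinuityZ3.Theorems.Transplant.FKDoubleFanOneSidedConeS
import Summits.CriticalPhenomena.PercolationContinuityZ3.Theorems.Transplant.FKDoubleFanOneSidedLamFloor
import HarnessLib

/-!
# Double fans `K₂ ∨ P_{m+1}`: the GADGET LEG of the closure statement `HypBaS` — `Λ`-floor gadgets and roof gadgets suffice

Helper file (`--supports stmt-CriticalPhenomena-4575`), FK sub-lane `prim-bschramm-fk-3` (gen 37); builds on p205010 (kernel theorem, internal audit
signed; external expert review pending).  No named facts, no sorries; standard axioms.  Memo `bschramm/prim-bschramm-fk-3/FAR-CROSS-XII.md` §5.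

In `HypBaS q` (`…OneSidedConeS`) the gadget `F ∈ InS q` acts on a frame pinned at its own apex, so the image `imgA q F w` is AFFINE along the
apex-`c` fibre of `F` (**`imgA_ffibre`**; read `F = swapAC (swapAB v)` in the frame `vecB` of `…CrossApexRoof`).  Since `InS` carries `Λ ≥ 0`
(and `Λ` is symmetric in the three edge classes, **`lam_swapAC_swapAB`**), the `Λ`-floor ray decomposition of `…OneSidedLamFloor` applies to the gadget
leg: the membership `opBC y' (imgA q F w) ∈ osConeS q` for all `F` with masses `≥ 0`, `Λ(F) ≥ 0`, `(U_c)(F)` follows from the memberships for the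
degenerate gadgets, the `Λ`-FLOOR gadgets `swapAC (swapAB (vecB q W y X Z u_Λ))` and the roof gadgets `swapAC (swapAB (roofV q κ l t w))`
(**`opBC_imgA_mem_of_gadget_endpoints`**, **`hypBaS_of_gadget_endpoints`**).  Unlike the input leg (`…OneSidedConeSInputs`), the `Λ`-floor of the
gadget leg does NOT reduce further along rulings: the image is quadratic in the gadget.  The floor `f₀ = 0` of `…OneSidedRays` is not available here:
its isolated cross term `genCtwo` is not in the cone (memo §5).
[folklore]
-/

noncomputable section

namespace Summit.CriticalPhenomena.PercolationContinuityZ3.Theorems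

namespace FK

namespace ThreeApex

/-- `Λ` is symmetric in the edge classes: `Λ(swapAC (swapAB v)) = Λ(v)`. [folklore] -/
theorem lam_swapAC_swapAB (v : V5) : lam (swapAC (swapAB v)) = lam v := by
  simp only [lam, swapAC, swapAB]; ring

/-- **The `a`-image is affine along the gadget's apex-`c` fibre.** [folklore] -/
theorem imgA_ffibre (q : ℝ) (w : V5) (W y X Z a b c : ℝ) :
    imgA q (swapAC (swapAB (vecB q W y X Z (c * a + (1 - c) * b)))) w =
      Biv.lin3 c (imgA q (swapAC (swapAB (vecB q W y X Z a))) w) (1 - c) (imgA q (swapAC (swapAB (vecB q W y X Z b))) w)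
        0 (wedgeH w w) := by
  ext <;> simp only [imgA, wedgeH, fanCombo, conv, edgeAC, detach, vecB, swapAB, swapAC, V5.total, hx, hy, hz, Biv.lin3, Biv.add,
    Biv.smul] <;> ring

/-- The functional `F ↦ ⟪∧²BC_{y'} · imgA q F w, γ⟫` is affine along the gadget fibre. [folklore] -/
theorem pairH_opBC_imgA_faffine (q y' : ℝ) (w : V5) (γ : Biv) (W y X Z a b c : ℝ) :
    pairH q (opBC y' (imgA q (swapAC (swapAB (vecB q W y X Z (c * a + (1 - c) * b)))) w)) γ =
      c * pairH q (opBC y' (imgA q (swapAC (swapAB (vecB q W y X Z a))) w)) γ +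
        (1 - c) * pairH q (opBC y' (imgA q (swapAC (swapAB (vecB q W y X Z b))) w)) γ := by
  rw [imgA_ffibre, opBC_lin3, pairH_lin3_left]; ring

/-- **Gadget endpoints suffice (one rest, one `b`-spoke).**  If `opBC y' (imgA q F w) ∈ osConeS q` for the degenerate gadgets, the `Λ`-floor
gadgets and the roof gadgets, then it holds for every gadget `F` with masses `≥ 0`, `Λ(F) ≥ 0` and `(U_c)(F)` (`0 < q < 1`). [folklore] -/
theorem opBC_imgA_mem_of_gadget_endpoints {q : ℝ} (hq0 : 0 < q) (hq1 : q < 1) {w : V5} {y' : ℝ}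
    (hdeg : ∀ y u0 : ℝ, 0 ≤ u0 → u0 ≤ y → opBC y' (imgA q (swapAC (swapAB (vecB q (q * y) y 0 0 u0))) w) ∈ osConeS q)
    (hlam : ∀ W y X Z uL : ℝ, 0 ≤ X → 0 ≤ Z → 0 ≤ uL → uL ≤ y → q * y < W → 0 ≤ W - q * y - X - Z →
      uL * (W - q * y) = X * y + X * Z + y * Z → opBC y' (imgA q (swapAC (swapAB (vecB q W y X Z uL))) w) ∈ osConeS q)
    (hroof : ∀ κ l t w₁ : ℝ, 0 ≤ κ → 0 < l → 0 ≤ t → 0 ≤ w₁ → w₁ ≤ 1 →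
      opBC y' (imgA q (swapAC (swapAB (roofV q κ l t w₁))) w) ∈ osConeS q)
    {F : V5} (hF : F.Nonneg) (hΛ : 0 ≤ lam F) (hU : UCond q (swapAC F)) : opBC y' (imgA q F w) ∈ osConeS q := by
  intro γ hγ
  have hv : (swapAB (swapAC F)).Nonneg := by obtain ⟨h0, h1, h2, h3, h4⟩ := hF; exact ⟨h0, h3, h1, h2, h4⟩
  have hU' : UCond q (swapAB (swapAB (swapAC F))) := by rwa [swapAB_swapAB]
  have hΛ' : 0 ≤ lam (swapAB (swapAC F)) := by
    have e : lam (swapAB (swapAC F)) = lam F := by simp only [lam, swapAC, swapAB]; ring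
    rw [e]; exact hΛ
  have := nonneg_of_lamfloor hq0 hq1 (Φ := fun v => pairH q (opBC y' (imgA q (swapAC (swapAB v)) w)) γ)
    (fun W y X Z a b c => pairH_opBC_imgA_faffine q y' w γ W y X Z a b c)
    (fun y u0 hu0 hu1 => hdeg y u0 hu0 hu1 γ hγ)
    (fun W y X Z uL hX hZ hL0 hLy hW h1 hfl => hlam W y X Z uL hX hZ hL0 hLy hW h1 hfl γ hγ)
    (fun κ l t w₁ hκ hl ht hw0 hw1 => hroof κ l t w₁ hκ hl ht hw0 hw1 γ hγ) hv hΛ' hU'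
  simpa only [swapAB_swapAB, swapAC_swapAC] using this

/-- **The gadget leg of `HypBaS` reduces to degenerate, `Λ`-floor and roof gadgets** (`0 < q < 1`; the rest `w ∈ InS q` and the spoke weight
`y' ∈ [0,1]` stay arbitrary). [folklore] -/
theorem hypBaS_of_gadget_endpoints {q : ℝ} (hq0 : 0 < q) (hq1 : q < 1)
    (hdeg : ∀ (w : V5) (y' y u0 : ℝ), InS q w → 0 ≤ y' → y' ≤ 1 → 0 ≤ u0 → u0 ≤ y →
      opBC y' (imgA q (swapAC (swapAB (vecB q (q * y) y 0 0 u0))) w) ∈ osConeS q)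
    (hlam : ∀ (w : V5) (y' W y X Z uL : ℝ), InS q w → 0 ≤ y' → y' ≤ 1 → 0 ≤ X → 0 ≤ Z → 0 ≤ uL → uL ≤ y → q * y < W →
      0 ≤ W - q * y - X - Z → uL * (W - q * y) = X * y + X * Z + y * Z →
      opBC y' (imgA q (swapAC (swapAB (vecB q W y X Z uL))) w) ∈ osConeS q)
    (hroof : ∀ (w : V5) (y' κ l t w₁ : ℝ), InS q w → 0 ≤ y' → y' ≤ 1 → 0 ≤ κ → 0 < l → 0 ≤ t → 0 ≤ w₁ → w₁ ≤ 1 →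
      opBC y' (imgA q (swapAC (swapAB (roofV q κ l t w₁))) w) ∈ osConeS q) :
    HypBaS q := by
  intro F w y' hF hw hy0 hy1
  exact opBC_imgA_mem_of_gadget_endpoints hq0 hq1
    (fun y u0 hu0 hu1 => hdeg w y' y u0 hw hy0 hy1 hu0 hu1)
    (fun W y X Z uL hX hZ hL0 hLy hW h1 hfl => hlam w y' W y X Z uL hw hy0 hy1 hX hZ hL0 hLy hW h1 hfl)
    (fun κ l t w₁ hκ hl ht hw0 hw1 => hroof w y' κ l t w₁ hw hy0 hy1 hκ hl ht hw0 hw1)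
    hF.valid.nonneg hF.valid.lam hF.uc

end ThreeApex

end FK

end Summit.CriticalPhenomena.PercolationContinuityZ3.Theorems
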